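import Summits.ValiantsHypothesis.ValiantsHypothesis.Theorems.LacunarySymmetroidMatrixDescartesDoorA26WallBubblingTwoSlopeLinking

/-!
# Wall bubbling for `DoorA26` — the SIGNED two-slope law: a ONE-SIGNED top class is impossible (alternation of the twenty's 21 coefficients)

HONEST FRAMING.  Helper theorems for the line `Cruxes/DoorA26/Lines/wall_bubbling.lean` (crux stmt-ValiantsHypothesis-19979 `DoorA26`; OPEN, typed,
never asserted), W2 seat val-sym-door-p1 g16, on top of W2 #34 `…WallBubblingTwoSlopeLinking`.  Def-free, Mathlib-only mathematics; nothing here bears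
on `DoorA26`, `MatrixDescartes` (stmt-ValiantsHypothesis-18050) or `VP ≠ VNP`; registers unchanged.

THE POINT.  A twenty has all 21 coefficients non-zero and STRICTLY ALTERNATING in value order, so every alive entry of every cluster limit carries the
known sign `s·(−1)^{pos(w)}`; in the two-slope top class of a vanishing minor (#34) the term of a matching `σ` therefore has the known sign
`sign σ · (−1)^{Σ_i pos(w_i)}`.  If these signs AGREE over the whole top class, the balance `Σ_{top} sign σ · Πγ = 0` is impossible — and this needs
neither a singleton class nor exact fine asymptotics: `false_of_topClass_oneSigned` below is the ROBUST form (moving exponents; only the divergence of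
the gaps between the class and its complement is used; inside the class nothing is assumed).  Located (this seat, kit j322210, exact, generic support,
C = 2, 2 608 chambers × 19 hinges): the signed law kills **38 484 / 49 552** profiles (the unsigned singleton law of #34/#35: 29 434) — ALL of
`m_small ∈ {7,8}`, 5 198/5 216 of 9, 2 594/2 608 of 10, and it reaches the END profiles: 1 290/5 216 of `m_small = 2`, 3 702/5 216 of `m_small = 3`
(none of `m_small = 1`); the 11 068 survivors are the end hinges `δ₀+δ₁` (all), `δ₀+δ₂` (1 412), `2δ₁` (1 069), `δ₀+δ₃` (344), `δ₀+δ₄` (51), `2δ₂` (45),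
`δ₀+δ₅` (10) and mirrors — only 412 of them with `m_small ≥ 4`.

[folklore] limits and signs of finite sums; [this work] the signed top-class kill.
-/

-- `Summit.ValiantsHypothesis.ValiantsHypothesis.…` repeats a component by the D-0017 layout
-- (single-conjunct summit), which the `dupNamespace` linter flags; the name is mandated.
set_option linter.dupNamespace false

namespace Summit.ValiantsHypothesis.ValiantsHypothesis.Theorems.LacunarySymmetroidMatrixDescartes.WallBubbling

open Finset Filter Topology
open scoped BigOperators

/-! ## §1 Abstract: a one-signed dominant class cannot balance -/

/-- **One-signed dominant class, robust form.**  Finitely many real sequences with `Σ_i X^ν_i = 0`; every index has a limit after its own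
exponential rescaling, `X^ν_i e^{E^ν_i} → c_i`; a non-empty class `T` on which all limits are STRICTLY POSITIVE; and every index outside `T` is dominated
by every index of `T` (`E^ν_i − E^ν_j → +∞` for `i ∉ T`, `j ∈ T`).  Contradiction.  (Nothing is assumed about the gaps INSIDE `T`.) [folklore] -/
theorem false_of_oneSigned_class {ι : Type*} [Fintype ι] [DecidableEq ι] (X E : ℕ → ι → ℝ) (c : ι → ℝ) (T : Finset ι)
    (j : ι) (hj : j ∈ T)
    (hX : ∀ i, Tendsto (fun ν => X ν i * Real.exp (E ν i)) atTop (𝓝 (c i)))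
    (hpos : ∀ i ∈ T, 0 < c i)
    (hgap : ∀ i, i ∉ T → ∀ j ∈ T, Tendsto (fun ν => E ν i - E ν j) atTop atTop)
    (hsum : ∀ ν, ∑ i, X ν i = 0) : False := by
  classical
  -- rescale everything by `e^{E^ν_j}` for the fixed `j ∈ T`
  set Y : ℕ → ι → ℝ := fun ν i => X ν i * Real.exp (E ν j) with hY
  have hYsum : ∀ ν, ∑ i, Y ν i = 0 := by
    intro ν; rw [hY]; simp only; rw [← Finset.sum_mul, hsum ν, zero_mul]
  -- inside `T`: eventually non-negative (positive limit after own rescaling, times a positive factor); at `j`: eventually > c j / 2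
  have hin : ∀ i ∈ T, ∀ᶠ ν in atTop, 0 ≤ Y ν i := by
    intro i hi
    have h := (hX i).eventually (lt_mem_nhds (hpos i hi))
    refine h.mono fun ν hν => ?_
    have : Y ν i = (X ν i * Real.exp (E ν i)) * Real.exp (E ν j - E ν i) := by
      rw [hY]; simp only; rw [mul_assoc, ← Real.exp_add]; congr 1; ring_nf
    rw [this]
    exact mul_nonneg hν.le (Real.exp_pos _).le
  have hjj : ∀ᶠ ν in atTop, c j / 2 < Y ν j := by
    have h := (hX j).eventually (lt_mem_nhds (show c j / 2 < c j by linarith [hpos j hj]))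
    exact h.mono fun ν hν => by rw [hY]; exact hν
  -- outside `T`: tends to zero
  have hout : ∀ i, i ∉ T → Tendsto (fun ν => Y ν i) atTop (𝓝 0) := by
    intro i hi
    have hfac : ∀ ν, Y ν i = (X ν i * Real.exp (E ν i)) * Real.exp (-(E ν i - E ν j)) := by
      intro ν; rw [hY]; simp only; rw [mul_assoc, ← Real.exp_add]; congr 1; ring
    simp_rw [hfac]
    have hexp : Tendsto (fun ν => Real.exp (-(E ν i - E ν j))) atTop (𝓝 0) :=
      Real.tendsto_exp_atBot.comp (tendsto_neg_atTop_atBot.comp (hgap i hi j hj))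
    simpa using (hX i).mul hexp
  -- the sum over the complement tends to zero, hence is eventually > −c j / 2
  have hout_sum : Tendsto (fun ν => ∑ i ∈ Tᶜ, Y ν i) atTop (𝓝 0) := by
    have := tendsto_finsetSum (Tᶜ) fun i (hi : i ∈ Tᶜ) => hout i (Finset.mem_compl.mp hi)
    simpa using this
  have hout_ev : ∀ᶠ ν in atTop, -(c j / 2) < ∑ i ∈ Tᶜ, Y ν i :=
    hout_sum.eventually (lt_mem_nhds (by linarith [hpos j hj]))
  have hin_ev : ∀ᶠ ν in atTop, ∀ i ∈ T, 0 ≤ Y ν i := (Finset.eventually_all T).mpr hin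
  obtain ⟨ν, hν1, hν2, hν3⟩ := (hin_ev.and (hjj.and hout_ev)).exists
  -- split the (zero) total sum
  have hsplit : ∑ i, Y ν i = ∑ i ∈ T, Y ν i + ∑ i ∈ Tᶜ, Y ν i :=
    (Finset.sum_add_sum_compl T (Y ν)).symm
  have hT : Y ν j ≤ ∑ i ∈ T, Y ν i :=
    Finset.single_le_sum (fun i hi => hν1 i hi) hj
  have := hYsum ν
  linarith

/-! ## §2 The signed two-slope kill for a vanishing minor -/

/-- **KILL, one-signed top class (robust).**  `k × k` minor of `G^ν` vanishing for every `ν`; entries with (possibly moving) two-slope asymptotics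
`G_pq/(R_p C_q)·e^{Δ^ν a^ν_pq} → γ_pq`; a non-empty class `T` of permutations whose signed `γ`-monomials `sign σ · Π_i γ_{r(σ i),c i}` are ALL STRICTLY
POSITIVE (resp. all strictly negative: apply to `−G`… or use `false_of_topClass_oneSigned_neg`), and every permutation outside `T` dominated by every
member of `T` after the rate.  Contradiction.  With `T` = the two-slope top class of #34 and the alternating sign pattern of a twenty this is the census's
SIGNED KILL. [this work] -/
theorem false_of_topClass_oneSigned {n k : ℕ} (G : ℕ → Matrix (Fin n) (Fin n) ℝ) (r c : Fin k → Fin n)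
    (hdet : ∀ ν, ((G ν).submatrix r c).det = 0)
    (γ : Fin n → Fin n → ℝ) (a : ℕ → Fin n → Fin n → ℝ) (R C : ℕ → Fin n → ℝ) (Δ : ℕ → ℝ)
    (hG : ∀ p q, Tendsto (fun ν => G ν p q / (R ν p * C ν q) * Real.exp (Δ ν * a ν p q)) atTop (𝓝 (γ p q)))
    (T : Finset (Equiv.Perm (Fin k))) (σ₀ : Equiv.Perm (Fin k)) (hσ₀ : σ₀ ∈ T)
    (hpos : ∀ σ ∈ T, 0 < ((Equiv.Perm.sign σ : ℤ) : ℝ) * ∏ i, γ (r (σ i)) (c i))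
    (hgap : ∀ σ, σ ∉ T → ∀ τ ∈ T,
      Tendsto (fun ν => Δ ν * (∑ i, a ν (r (σ i)) (c i)) - Δ ν * (∑ i, a ν (r (τ i)) (c i))) atTop atTop) : False := by
  classical
  exact false_of_oneSigned_class
    (fun ν σ => ((Equiv.Perm.sign σ : ℤ) : ℝ) * (∏ i, G ν (r (σ i)) (c i)) / ((∏ i, R ν (r i)) * ∏ i, C ν (c i)))
    (fun ν σ => Δ ν * ∑ i, a ν (r (σ i)) (c i))
    (fun σ => ((Equiv.Perm.sign σ : ℤ) : ℝ) * ∏ i, γ (r (σ i)) (c i)) T σ₀ hσ₀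
    (fun σ => minor_term_tendsto G r c γ a R C Δ hG σ) hpos hgap (minor_terms_sum_eq_zero G r c hdet R C)

/-- **KILL, one-signed top class, negative version.** [this work] -/
theorem false_of_topClass_oneSigned_neg {n k : ℕ} (G : ℕ → Matrix (Fin n) (Fin n) ℝ) (r c : Fin k → Fin n)
    (hdet : ∀ ν, ((G ν).submatrix r c).det = 0)
    (γ : Fin n → Fin n → ℝ) (a : ℕ → Fin n → Fin n → ℝ) (R C : ℕ → Fin n → ℝ) (Δ : ℕ → ℝ)
    (hG : ∀ p q, Tendsto (fun ν => G ν p q / (R ν p * C ν q) * Real.exp (Δ ν * a ν p q)) atTop (𝓝 (γ p q)))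
    (T : Finset (Equiv.Perm (Fin k))) (σ₀ : Equiv.Perm (Fin k)) (hσ₀ : σ₀ ∈ T)
    (hneg : ∀ σ ∈ T, ((Equiv.Perm.sign σ : ℤ) : ℝ) * ∏ i, γ (r (σ i)) (c i) < 0)
    (hgap : ∀ σ, σ ∉ T → ∀ τ ∈ T,
      Tendsto (fun ν => Δ ν * (∑ i, a ν (r (σ i)) (c i)) - Δ ν * (∑ i, a ν (r (τ i)) (c i))) atTop atTop) : False := by
  classical
  -- negate every term: same identity, same exponents, positive limits
  refine false_of_oneSigned_class
    (fun ν σ => -(((Equiv.Perm.sign σ : ℤ) : ℝ) * (∏ i, G ν (r (σ i)) (c i)) / ((∏ i, R ν (r i)) * ∏ i, C ν (c i))))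
    (fun ν σ => Δ ν * ∑ i, a ν (r (σ i)) (c i))
    (fun σ => -(((Equiv.Perm.sign σ : ℤ) : ℝ) * ∏ i, γ (r (σ i)) (c i))) T σ₀ hσ₀
    (fun σ => ?_) (fun σ hσ => neg_pos.mpr (hneg σ hσ)) hgap (fun ν => ?_)
  · have := (minor_term_tendsto G r c γ a R C Δ hG σ).neg
    refine this.congr' (Eventually.of_forall fun ν => ?_)
    simp only [neg_mul]
  · simp only [Finset.sum_neg_distrib, minor_terms_sum_eq_zero G r c hdet R C ν, neg_zero]

end Summit.ValiantsHypothesis.ValiantsHypothesis.Theorems.LacunarySymmetroidMatrixDescartes.WallBubbling
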